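import Summits.Ventures.PercRepro.ProfilePointedCircuitClassesStarSharpAsmA

/-!
# PercRepro — THE ASSEMBLY OF `StarNineSharp`, PART B: A COLOOP OF `R` IN `X`
(p5, gen 56; `proofs/P5-GM1.md` §84)

With a coloop `c ∈ X = E₇ − e − f` of `R = N ∖ {b, b′}` (`ρ(E₇ − c) = 3`) every bi-independent 4-set contains
exactly one of `c, b, b′`; the demands `T + b` (`e ∈ T ⊆ E₇ − c`) inject into the targets `(E₇ − c − T) + b` and the
demands `T + c` into the targets `(E₇ − c − T) + c` (`inCount_thru_le_of_coloop_X`), the two images being separated by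
the membership of `b`.
-/

open scoped Matroid

namespace PercRepro.Cogirth

open Finset ThmH Skew Shadow Profile

open Classical

variable {α : Type} [DecidableEq α] {N : Matroid α} [N.Finite]

section StarSharpAsmB

variable {b b' : α}

/-- `E ∖ ((E − c) ∖ T) = T + c` for `c ∈ E`, `T ⊆ E − c`. -/
theorem sdiff_sdiff_erase_eq_insert_c {E T : Finset α} {c : α} (hc : c ∈ E) (hT : T ⊆ E.erase c) :
    E \ (E.erase c \ T) = insert c T := by
  ext z
  rw [mem_sdiff, mem_insert]
  constructor
  · rintro ⟨hzE, hz⟩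
    by_cases hzc : z = c
    · exact Or.inl hzc
    · right
      by_contra hzT
      exact hz (mem_sdiff.2 ⟨mem_erase.2 ⟨hzc, hzE⟩, hzT⟩)
  · rintro (rfl | hzT)
    · exact ⟨hc, fun h' => (mem_erase.1 (mem_sdiff.1 h').1).1 rfl⟩
    · exact ⟨(mem_erase.1 (hT hzT)).2, fun h' => (mem_sdiff.1 h').2 hzT⟩

/-- `E ∖ (((E − c) ∖ T) + c) = T` for `T ⊆ E − c`. -/
theorem sdiff_insert_sdiff_erase_eq_c {E T : Finset α} {c : α} (hT : T ⊆ E.erase c) :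
    E \ insert c (E.erase c \ T) = T := by
  ext z
  rw [mem_sdiff, mem_insert]
  constructor
  · rintro ⟨hzE, hz⟩
    by_contra hzT
    by_cases hzc : z = c
    · exact hz (Or.inl hzc)
    · exact hz (Or.inr (mem_sdiff.2 ⟨mem_erase.2 ⟨hzc, hzE⟩, hzT⟩))
  · intro hzT
    have hz := mem_erase.1 (hT hzT)
    refine ⟨hz.2, ?_⟩
    rintro (h' | h')
    · exact hz.1 h'
    · exact (mem_sdiff.1 h').2 hzT

/-- **A COLOOP `c ∈ X` OF `R`**: the `b′`-avoiding inequality. -/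
theorem inCount_thru_le_of_coloop_X (hn : (gr N).card = 9) (hR : rk N (gr N) = 5)
    (hcf : ∀ x ∈ gr N, rk N ((gr N).erase x) = 5) (h : SeriesPair N b b') {e f : α} (hf : f ∈ gr N)
    (hfb : f ≠ b) (hfb' : f ≠ b') (hE7 : rk N (((gr N).erase b).erase b') = 4)
    {c : α} (hcX : c ∈ ((((gr N).erase b).erase b').erase f).erase e)
    (hcR : rk N ((((gr N).erase b).erase b').erase c) = 3) :
    inCount N 4 e + thruCount N 4 {b', f} + thruCount N 4 {b', e, f} ≤
      inCount N 4 f + thruCount N 4 {e, f} + thruCount N 4 {b', e} := by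
  rw [inCount_thru_split']
  have hb : b ∈ gr N := h.1; have hb' : b' ∈ gr N := h.2.1; have hbb' : b ≠ b' := h.2.2.1
  have hE7g : ((gr N).erase b).erase b' ⊆ gr N := (erase_subset _ _).trans (erase_subset _ _)
  have hcE : c ∈ ((gr N).erase b).erase b' := (erase_subset _ _) ((erase_subset _ _) hcX)
  have hcf' : c ≠ f := (mem_erase.1 (mem_erase.1 hcX).2).1
  have hcb : c ≠ b := (mem_erase.1 (mem_erase.1 hcE).2).1
  have hcb' : c ≠ b' := (mem_erase.1 hcE).1
  have hfE : f ∈ ((gr N).erase b).erase b' := mem_erase.2 ⟨hfb', mem_erase.2 ⟨hfb, hf⟩⟩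
  have hE7c : (((gr N).erase b).erase b').card = 7 := by
    rw [card_erase_of_mem (mem_erase.2 ⟨hbb'.symm, hb'⟩), card_erase_of_mem hb, hn]
  have hEc6 : ((((gr N).erase b).erase b').erase c).card = 6 := by rw [card_erase_of_mem hcE, hE7c]
  have hcup : rk N (insert c ((((gr N).erase b).erase b').erase c)) = rk N ((((gr N).erase b).erase b').erase c) + 1 := by
    rw [insert_erase hcE, hE7, hcR]
  -- the rank of a 3-subset `T` of `E₇ − c` whose complement in `E₇ − c` has rank 3 spans `E₇ − c`
  have hspan : ∀ T ⊆ (((gr N).erase b).erase b').erase c, rk N T = 3 →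
      ∀ z ∈ (((gr N).erase b).erase b').erase c, rk N (insert z T) = rk N T := by
    intro T hT hT3 z hz
    exact rk_insert_eq_of_subset_rk_eq' hT (by rw [hcR, hT3]) (by rw [insert_eq_of_mem hz])
  have hD := card_filter_add_card_filter_not (s := (biIndepSets N 4).filter (fun W => (e ∈ W ∧ f ∉ W) ∧ b' ∉ W))
    (fun W => b ∈ W)
  have hT := card_filter_add_card_filter_not (s := (biIndepSets N 4).filter (fun W => f ∈ W ∧ b' ∉ W))
    (fun W => b ∈ W)
  simp only [filter_filter] at hD hT
  -- PART 1: the demands containing `b`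
  have h1 : ((biIndepSets N 4).filter (fun W => ((e ∈ W ∧ f ∉ W) ∧ b' ∉ W) ∧ b ∈ W)).card ≤
      ((biIndepSets N 4).filter (fun W => (f ∈ W ∧ b' ∉ W) ∧ b ∈ W)).card := by
    apply card_le_card_of_injOn (fun W => insert b ((((gr N).erase b).erase b').erase c \ W.erase b))
    · intro W hW
      simp only [mem_coe, mem_filter] at hW ⊢
      obtain ⟨hWs, ⟨⟨heW, hfW⟩, hb'W⟩, hbW⟩ := hW
      obtain ⟨hWg, hW4, hWr, hWc⟩ := mem_biIndepSets.1 hWs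
      have hcW : c ∉ W := by
        intro hcW
        have := card_inter_le_one_of_coloop hn h hcR hWs
        have h2 : ({c, b} : Finset α) ⊆ W ∩ {c, b, b'} := by
          intro z hz; simp only [mem_insert, mem_singleton] at hz
          rcases hz with rfl | rfl
          · exact mem_inter.2 ⟨hcW, mem_insert_self _ _⟩
          · exact mem_inter.2 ⟨hbW, mem_insert_of_mem (mem_insert_self _ _)⟩
        have := card_le_card h2
        rw [card_pair hcb] at this
        omega
      have hTsub : W.erase b ⊆ (((gr N).erase b).erase b').erase c := fun z hz =>
        mem_erase.2 ⟨fun h' => hcW (h' ▸ mem_of_mem_erase hz), mem_erase.2 ⟨fun h' => hb'W (h' ▸ mem_of_mem_erase hz),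
          mem_erase.2 ⟨(mem_erase.1 hz).1, hWg (mem_of_mem_erase hz)⟩⟩⟩
      have hT3 : (W.erase b).card = 3 := by rw [card_erase_of_mem hbW, hW4]
      have hTr : rk N (W.erase b) = 3 := by
        have h1 := rk_le_card' (M := N) (W.erase b)
        have h2 : rk N W ≤ rk N (W.erase b) + 1 := by
          have := rk_insert_le_add_one (N := N) (hWg hbW) (X := W.erase b) ((erase_subset _ _).trans hWg)
          rwa [insert_erase hbW] at this
        rw [hT3] at h1; rw [hWr, hW4] at h2; omega
      have hS'E : (((gr N).erase b).erase b').erase c \ W.erase b ⊆ ((gr N).erase b).erase b' :=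
        sdiff_subset.trans (erase_subset _ _)
      have hS'3 : ((((gr N).erase b).erase b').erase c \ W.erase b).card = 3 := by
        rw [card_sdiff_of_subset hTsub, hEc6, hT3]
      have hS'r : rk N ((((gr N).erase b).erase b').erase c \ W.erase b) = 3 := by
        have hsub : gr N \ W ⊆ insert b' (insert c ((((gr N).erase b).erase b').erase c \ W.erase b)) := by
          intro z hz
          rw [mem_sdiff] at hz
          by_cases hzb' : z = b'
          · rw [hzb']; exact mem_insert_self _ _
          by_cases hzc : z = c
          · rw [hzc]; exact mem_insert_of_mem (mem_insert_self _ _)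
          · have hzb : z ≠ b := fun h' => hz.2 (h' ▸ hbW)
            exact mem_insert_of_mem (mem_insert_of_mem (mem_sdiff.2 ⟨mem_erase.2 ⟨hzc, mem_erase.2 ⟨hzb', mem_erase.2 ⟨hzb, hz.1⟩⟩⟩,
              fun h' => hz.2 (mem_of_mem_erase h')⟩))
        have h2 := rk_mono' (M := N) hsub
        have h3 := rk_insert_le_add_one (N := N) hb' (X := insert c ((((gr N).erase b).erase b').erase c \ W.erase b))
          (insert_subset (hE7g hcE) (hS'E.trans hE7g))
        have h4 := rk_insert_le_add_one (N := N) (hE7g hcE) (X := (((gr N).erase b).erase b').erase c \ W.erase b)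
          (hS'E.trans hE7g)
        have h5 := rk_le_card' (M := N) ((((gr N).erase b).erase b').erase c \ W.erase b)
        have h6 : (gr N \ W).card = 5 := by rw [card_sdiff_of_subset hWg, hn, hW4]
        rw [hWc, h6] at h2
        rw [hS'3] at h5
        omega
      refine ⟨?_, ⟨?_, ?_⟩, mem_insert_self _ _⟩
      · rw [insert_b_mem_biIndepSets_iff h hn hS'E hS'3, sdiff_sdiff_erase_eq_insert_c hcE hTsub]
        refine ⟨hS'r, ?_⟩
        have := rk_insert_eq_add_one_of_subset_flat (N := N) (H := (((gr N).erase b).erase b').erase c) (S := W.erase b)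
          (z := c) (hE7g hcE) ((erase_subset _ _).trans hE7g) hTsub hcup
        rw [this, hTr]
      · exact mem_insert_of_mem (mem_sdiff.2 ⟨mem_erase.2 ⟨hcf'.symm, hfE⟩, fun h' => hfW (mem_of_mem_erase h')⟩)
      · intro h'
        rcases mem_insert.1 h' with h'' | h''
        · exact hbb' h''.symm
        · exact (mem_erase.1 ((erase_subset c (((gr N).erase b).erase b')) (mem_sdiff.1 h'').1)).1 rfl
    · intro W₁ hW₁ W₂ hW₂ heq
      simp only [mem_coe, mem_filter] at hW₁ hW₂
      have hsub : ∀ W ∈ biIndepSets N 4, c ∉ W → b' ∉ W → W.erase b ⊆ (((gr N).erase b).erase b').erase c := by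
        intro W hW hcW hb'W z hz
        exact mem_erase.2 ⟨fun h' => hcW (h' ▸ mem_of_mem_erase hz), mem_erase.2 ⟨fun h' => hb'W (h' ▸ mem_of_mem_erase hz),
          mem_erase.2 ⟨(mem_erase.1 hz).1, (mem_biIndepSets.1 hW).1 (mem_of_mem_erase hz)⟩⟩⟩
      have hcW : ∀ W ∈ biIndepSets N 4, b ∈ W → c ∉ W := by
        intro W hW hbW hcW
        have := card_inter_le_one_of_coloop hn h hcR hW
        have h2 : ({c, b} : Finset α) ⊆ W ∩ {c, b, b'} := by
          intro z hz; simp only [mem_insert, mem_singleton] at hz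
          rcases hz with rfl | rfl
          · exact mem_inter.2 ⟨hcW, mem_insert_self _ _⟩
          · exact mem_inter.2 ⟨hbW, mem_insert_of_mem (mem_insert_self _ _)⟩
        have := card_le_card h2
        rw [card_pair hcb] at this
        omega
      have hT₁ := hsub W₁ hW₁.1 (hcW W₁ hW₁.1 hW₁.2.2) hW₁.2.1.2
      have hT₂ := hsub W₂ hW₂.1 (hcW W₂ hW₂.1 hW₂.2.2) hW₂.2.1.2
      have hbS : ∀ T : Finset α, b ∉ (((gr N).erase b).erase b').erase c \ T := fun T h' =>
        (mem_erase.1 (mem_erase.1 ((erase_subset c (((gr N).erase b).erase b')) (mem_sdiff.1 h').1)).2).1 rfl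
      have heq' : insert b ((((gr N).erase b).erase b').erase c \ W₁.erase b) =
          insert b ((((gr N).erase b).erase b').erase c \ W₂.erase b) := heq
      have h1 : (insert b ((((gr N).erase b).erase b').erase c \ W₁.erase b)).erase b =
          (insert b ((((gr N).erase b).erase b').erase c \ W₂.erase b)).erase b := by rw [heq']
      rw [erase_insert (hbS _), erase_insert (hbS _)] at h1
      have h2 : (((gr N).erase b).erase b').erase c \ ((((gr N).erase b).erase b').erase c \ W₁.erase b) =
          (((gr N).erase b).erase b').erase c \ ((((gr N).erase b).erase b').erase c \ W₂.erase b) := by rw [h1]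
      rw [Finset.sdiff_sdiff_eq_self hT₁, Finset.sdiff_sdiff_eq_self hT₂] at h2
      rw [← insert_erase hW₁.2.2, ← insert_erase hW₂.2.2, h2]
  -- PART 2: the demands avoiding `b`
  have h2 : ((biIndepSets N 4).filter (fun W => ((e ∈ W ∧ f ∉ W) ∧ b' ∉ W) ∧ b ∉ W)).card ≤
      ((biIndepSets N 4).filter (fun W => (f ∈ W ∧ b' ∉ W) ∧ b ∉ W)).card := by
    apply card_le_card_of_injOn (fun W => insert c ((((gr N).erase b).erase b').erase c \ W.erase c))
    · intro W hW
      simp only [mem_coe, mem_filter] at hW ⊢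
      obtain ⟨hWs, ⟨⟨heW, hfW⟩, hb'W⟩, hbW⟩ := hW
      obtain ⟨hWg, hW4, hWr, hWc⟩ := mem_biIndepSets.1 hWs
      have hcW : c ∈ W := by
        by_contra hcW
        have hsub : W ⊆ (((gr N).erase b).erase b').erase c := fun z hz =>
          mem_erase.2 ⟨fun h' => hcW (h' ▸ hz), mem_erase.2 ⟨fun h' => hb'W (h' ▸ hz),
            mem_erase.2 ⟨fun h' => hbW (h' ▸ hz), hWg hz⟩⟩⟩
        have := rk_mono' (M := N) hsub
        rw [hcR, hWr, hW4] at this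
        omega
      have hTsub : W.erase c ⊆ (((gr N).erase b).erase b').erase c := fun z hz =>
        mem_erase.2 ⟨(mem_erase.1 hz).1, mem_erase.2 ⟨fun h' => hb'W (h' ▸ mem_of_mem_erase hz),
          mem_erase.2 ⟨fun h' => hbW (h' ▸ mem_of_mem_erase hz), hWg (mem_of_mem_erase hz)⟩⟩⟩
      have hT3 : (W.erase c).card = 3 := by rw [card_erase_of_mem hcW, hW4]
      have hTr : rk N (W.erase c) = 3 := by
        have h1 := rk_le_card' (M := N) (W.erase c)
        have h2 : rk N W ≤ rk N (W.erase c) + 1 := by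
          have := rk_insert_le_add_one (N := N) (hWg hcW) (X := W.erase c) ((erase_subset _ _).trans hWg)
          rwa [insert_erase hcW] at this
        rw [hT3] at h1; rw [hWr, hW4] at h2; omega
      have hS'E : (((gr N).erase b).erase b').erase c \ W.erase c ⊆ (((gr N).erase b).erase b').erase c := sdiff_subset
      have hS'3 : ((((gr N).erase b).erase b').erase c \ W.erase c).card = 3 := by
        rw [card_sdiff_of_subset hTsub, hEc6, hT3]
      have hS'r : rk N ((((gr N).erase b).erase b').erase c \ W.erase c) = 3 := by
        have hsub : gr N \ W ⊆ insert b (insert b' ((((gr N).erase b).erase b').erase c \ W.erase c)) := by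
          intro z hz
          rw [mem_sdiff] at hz
          by_cases hzb : z = b
          · rw [hzb]; exact mem_insert_self _ _
          by_cases hzb' : z = b'
          · rw [hzb']; exact mem_insert_of_mem (mem_insert_self _ _)
          · have hzc : z ≠ c := fun h' => hz.2 (h' ▸ hcW)
            exact mem_insert_of_mem (mem_insert_of_mem (mem_sdiff.2 ⟨mem_erase.2 ⟨hzc, mem_erase.2 ⟨hzb', mem_erase.2 ⟨hzb, hz.1⟩⟩⟩,
              fun h' => hz.2 (mem_of_mem_erase h')⟩))
        have h2 := rk_mono' (M := N) hsub
        have h3 := rk_insert_le_add_one (N := N) hb (X := insert b' ((((gr N).erase b).erase b').erase c \ W.erase c))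
          (insert_subset hb' ((hS'E.trans (erase_subset _ _)).trans hE7g))
        have h4 := rk_insert_le_add_one (N := N) hb' (X := (((gr N).erase b).erase b').erase c \ W.erase c)
          ((hS'E.trans (erase_subset _ _)).trans hE7g)
        have h5 := rk_le_card' (M := N) ((((gr N).erase b).erase b').erase c \ W.erase c)
        have h6 : (gr N \ W).card = 5 := by rw [card_sdiff_of_subset hWg, hn, hW4]
        rw [hWc, h6] at h2
        rw [hS'3] at h5
        omega
      have hcS : c ∉ (((gr N).erase b).erase b').erase c \ W.erase c := fun h' =>
        (mem_erase.1 (mem_sdiff.1 h').1).1 rfl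
      have hBE : insert c ((((gr N).erase b).erase b').erase c \ W.erase c) ⊆ ((gr N).erase b).erase b' :=
        insert_subset hcE (hS'E.trans (erase_subset _ _))
      have hB4 : (insert c ((((gr N).erase b).erase b').erase c \ W.erase c)).card = 4 := by
        rw [card_insert_of_notMem hcS, hS'3]
      refine ⟨?_, ⟨?_, ?_⟩, ?_⟩
      · rw [mem_biIndepSets_iff_of_subset_E7 h hn hBE hB4, sdiff_insert_sdiff_erase_eq_c hTsub]
        constructor
        · have := rk_insert_eq_add_one_of_subset_flat (N := N) (H := (((gr N).erase b).erase b').erase c)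
            (S := (((gr N).erase b).erase b').erase c \ W.erase c) (z := c) (hE7g hcE)
            ((erase_subset _ _).trans hE7g) hS'E hcup
          rw [this, hS'r]
        · have hcl := hspan (W.erase c) hTsub hTr
          have hcl' : ∀ z ∈ (((gr N).erase b).erase b').erase c,
              rk N (insert z (insert b (insert b' (W.erase c)))) = rk N (insert b (insert b' (W.erase c))) := fun z hz =>
            rk_insert_eq_of_rk_insert_eq_subset' (N := N) ((subset_insert _ _).trans (subset_insert _ _)) (hcl z hz)
          have h5 := rk_union_eq_of_forall_insert_eq (N := N) (Y := insert b (insert b' (W.erase c))) _ hcl'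
          have h6 : rk N ((gr N).erase c) ≤ rk N (insert b (insert b' (W.erase c)) ∪ (((gr N).erase b).erase b').erase c) := by
            apply rk_mono'
            intro z hz
            by_cases hzb : z = b
            · rw [hzb]; exact mem_union_left _ (mem_insert_self _ _)
            by_cases hzb' : z = b'
            · rw [hzb']; exact mem_union_left _ (mem_insert_of_mem (mem_insert_self _ _))
            · exact mem_union_right _ (mem_erase.2 ⟨(mem_erase.1 hz).1, mem_erase.2 ⟨hzb', mem_erase.2 ⟨hzb, mem_of_mem_erase hz⟩⟩⟩)
          have h7 : rk N (insert b (insert b' (W.erase c))) ≤ rk N (gr N) :=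
            rk_mono' (insert_subset hb (insert_subset hb' ((erase_subset _ _).trans hWg)))
          rw [hcf c (hE7g hcE), h5] at h6
          rw [hR] at h7
          omega
      · exact mem_insert_of_mem (mem_sdiff.2 ⟨mem_erase.2 ⟨hcf'.symm, hfE⟩, fun h' => hfW (mem_of_mem_erase h')⟩)
      · intro h'
        rcases mem_insert.1 h' with h'' | h''
        · exact hcb' h''.symm
        · exact (mem_erase.1 ((erase_subset c (((gr N).erase b).erase b')) (mem_sdiff.1 h'').1)).1 rfl
      · intro h'
        rcases mem_insert.1 h' with h'' | h''
        · exact hcb h''.symm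
        · exact (mem_erase.1 (mem_erase.1 ((erase_subset c (((gr N).erase b).erase b')) (mem_sdiff.1 h'').1)).2).1 rfl
    · intro W₁ hW₁ W₂ hW₂ heq
      simp only [mem_coe, mem_filter] at hW₁ hW₂
      have hcW : ∀ W ∈ biIndepSets N 4, b ∉ W → b' ∉ W → c ∈ W := by
        intro W hW hbW hb'W
        by_contra hcW
        obtain ⟨hWg, hW4, hWr, -⟩ := mem_biIndepSets.1 hW
        have hsub : W ⊆ (((gr N).erase b).erase b').erase c := fun z hz =>
          mem_erase.2 ⟨fun h' => hcW (h' ▸ hz), mem_erase.2 ⟨fun h' => hb'W (h' ▸ hz),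
            mem_erase.2 ⟨fun h' => hbW (h' ▸ hz), hWg hz⟩⟩⟩
        have := rk_mono' (M := N) hsub
        rw [hcR, hWr, hW4] at this
        omega
      have hsub : ∀ W ∈ biIndepSets N 4, b ∉ W → b' ∉ W → W.erase c ⊆ (((gr N).erase b).erase b').erase c := by
        intro W hW hbW hb'W z hz
        exact mem_erase.2 ⟨(mem_erase.1 hz).1, mem_erase.2 ⟨fun h' => hb'W (h' ▸ mem_of_mem_erase hz),
          mem_erase.2 ⟨fun h' => hbW (h' ▸ mem_of_mem_erase hz), (mem_biIndepSets.1 hW).1 (mem_of_mem_erase hz)⟩⟩⟩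
      have hT₁ := hsub W₁ hW₁.1 hW₁.2.2 hW₁.2.1.2
      have hT₂ := hsub W₂ hW₂.1 hW₂.2.2 hW₂.2.1.2
      have hcS : ∀ T : Finset α, c ∉ (((gr N).erase b).erase b').erase c \ T := fun T h' =>
        (mem_erase.1 (mem_sdiff.1 h').1).1 rfl
      have heq' : insert c ((((gr N).erase b).erase b').erase c \ W₁.erase c) =
          insert c ((((gr N).erase b).erase b').erase c \ W₂.erase c) := heq
      have h1 : (insert c ((((gr N).erase b).erase b').erase c \ W₁.erase c)).erase c =
          (insert c ((((gr N).erase b).erase b').erase c \ W₂.erase c)).erase c := by rw [heq']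
      rw [erase_insert (hcS _), erase_insert (hcS _)] at h1
      have h2 : (((gr N).erase b).erase b').erase c \ ((((gr N).erase b).erase b').erase c \ W₁.erase c) =
          (((gr N).erase b).erase b').erase c \ ((((gr N).erase b).erase b').erase c \ W₂.erase c) := by rw [h1]
      rw [Finset.sdiff_sdiff_eq_self hT₁, Finset.sdiff_sdiff_eq_self hT₂] at h2
      rw [← insert_erase (hcW W₁ hW₁.1 hW₁.2.2 hW₁.2.1.2), ← insert_erase (hcW W₂ hW₂.1 hW₂.2.2 hW₂.2.1.2), h2]
  omega

end StarSharpAsmB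

end PercRepro.Cogirth
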